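import Mathlib
import HarnessLib
import Literature.MeasureTheory.Integral.PolarSectorIntegral
import Literature.MeasureTheory.Integral.SphericalBoxIntegral

/-!
# `π`-free box forms of triple integrals over balls, shells and spherical wedges

Topic `Literature/MeasureTheory/Integral`; namespace `Literature.MeasureTheory.Integral`.  Companion of
`SphericalBoxIntegral.lean` (Hurley, *Intermediate Calculus* (1980), Sect. 5.8, Theorem 8.5:
`∭_B f dV = ∫∫∫ f ρ² sin φ dθ dφ dρ`) and of the half-angle section of `PolarSectorIntegral.lean`.

THE POINT.  Theorem 8.5 turns a ball `{x² + y² + z² ≤ R²}` into the box `[0, R] × [0, π] × [-π, π]` in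
`(ρ, φ, θ)`.  A certificate language whose boxes have RATIONAL endpoints and whose expressions have no constant
`π` (the kernel-checked product Gauss–Legendre certificates `Literature/Analysis/ValidatedNumerics/GaussLegendreCertND`)
cannot take the two angular axes as they stand.  Two classical one-dimensional substitutions remove `π`:

* the polar angle by `t = cos φ` (`dt = -sin φ dφ`, `sin φ = √(1 - t²)` on `[0, π]`), which ALSO absorbs the
  weight `sin φ`:  `∫_0^π sin φ · H(cos φ, sin φ) dφ = ∫_{-1}^{1} H(t, √(1 - t²)) dt`
  (`integral_sin_mul_trig_zero_pi_eq_integral_cos`); or by the tangent half-angle substitution `φ = 2 arctan v`,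
  `v ∈ [0, 1]`, after folding `[0, π]` onto `[0, π/2]` by the reflection `φ ↦ π - φ`
  (`integral_trig_zero_pi_eq_halfRange`, `integral_trig_zero_pi_eq_integral_halfAngle`:
  `∫_0^π H(cos φ, sin φ) dφ = ∫_0^1 2/(1+v²) · (H(c, s) + H(-c, s)) dv`, `c = (1-v²)/(1+v²)`, `s = 2v/(1+v²)` —
  Marsden–Weinstein, *Calculus II*, Sect. 10.2 (8)–(10): `sin x = 2u/(1+u²)`, `cos x = (1-u²)/(1+u²)`,
  `dx = 2 du/(1+u²)`);
* the azimuth `θ ∈ [-π, π]` by the half-angle substitution of `PolarSectorIntegral.lean`, restated here for a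
  general continuous `H(cos θ, sin θ)` (`integral_trig_negPi_pi_eq_integral_halfAngle(₄)`, two terms over
  `u ∈ [-1, 1]` or four over `u ∈ [0, 1]`).

WHAT IS PROVED (Lebesgue integrals, `volume` on `(ℝ × ℝ) × ℝ`, continuous `f : (ℝ × ℝ) × ℝ → ℝ`):

* the inner two angular integrals of the spherical integrand in `t = cos φ` form
  (`integral_sphericalIntegrand_polarAngle_eq_integral_cos`:
  `∫_0^π ∫_α^β ρ² sin φ f((ρ sin φ cos θ, ρ sin φ sin θ), ρ cos φ) dθ dφ
     = ∫_{-1}^1 ∫_α^β ρ² f((ρ s cos θ, ρ s sin θ), ρ t) dθ dt`, `s = √(1 - t²)`) and in half-angle form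
  (`integral_sphericalIntegrand_polarAngle_eq_integral_halfAngle`, `v ∈ [0, 1]`, two terms `z = ±ρ c`);
* spherical wedges with the full polar angle, `sphericalBox ρ₁ ρ₂ 0 π α β`
  (`setIntegral_sphericalBox_polarFull_eq_iterated_cos`), shells (`setIntegral_shell_eq_iterated_cos`) and balls
  (`setIntegral_ball_eq_iterated_cos`:
  `∫ p in {x²+y²+z² ≤ R²}, f p = ∫ ρ in 0..R, ∫ t in -1..1, ∫ θ in -π..π, ρ² f((ρ s cos θ, ρ s sin θ), ρ t)`);
* the FULLY `π`-FREE ball and shell: `setIntegral_ball_eq_iterated_cos_halfAngle₄` /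
  `setIntegral_shell_eq_iterated_cos_halfAngle₄` — the box `[0, R] × [-1, 1] × [0, 1]` in `(ρ, t, u)` with the
  four-term integrand `2/(1+u²) · Σ_{±,±} ρ² f((±ρ s c_u, ±ρ s s_u), ρ t)`, `c_u = (1-u²)/(1+u²)`,
  `s_u = 2u/(1+u²)` — and the all-rational form `setIntegral_ball_eq_iterated_halfAngle₈` over
  `[0, R] × [0, 1] × [0, 1]` in `(ρ, v, u)` (eight terms, no square root: the form to use when `f` is analytic
  but not even in `(x, y)`, since `√(1 - t²)` is not analytic at `t = ±1`).

WHY IT IS HERE.  With these forms a ball or shell integral of an integrand built from the operations of the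
certificate language is an iterated integral over a box with rational endpoints of such an integrand, so a plain
box certificate applies (for `f` depending on `(x, y)` through `x² + y²` the `t`-form is already polynomial in
`t`: `x² + y² = ρ² (1 - t²)`).  In-tree neighbours: `SphericalBoxIntegral.lean` (the charts, the change of
variables, Theorem 8.5 — imported), `PolarSectorIntegral.lean` (the planar half-angle forms — imported and
generalised to `H(cos θ, sin θ)`), `Literature/Analysis/SpecialFunctions` / `NumberTheory` files using
`cos (2 arctan u)` pointwise, and `Literature.Geometry.Lorentzian.StaticMasslessVlasovShellProofs.integral_sin_mul_comp_cos`
(`∫_0^π sin θ F(cos θ) dθ = ∫_{-1}^1 F`, the case of `H` not depending on `sin φ`; not imported — unrelated topic).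
New here: the substitutions carried through the ITERATED spherical integral and the
resulting region theorems.  HONEST FRAMING: textbook substitutions formalised as glue; every published number
belongs to a client cell's ledger and its rigour lives in the kernel-checked verifier it cites.  Deliberately NOT
here: general polar-angle ranges `[φ₁, φ₂]` (only the full range `[0, π]` is substituted; a cone `φ ≤ φ₂` is the
`t`-range `[cos φ₂, 1]`, left to the user via `SphericalBoxIntegral`), cylindrical coordinates (the `z`-axis is
already Cartesian), improper regions.  Everything is proved; no named fact, no axiom, no `sorry`.

References: [cite: Hurley1980, Sect. 5.8 Thm. 8.5]; [cite: MarsdenWeinstein1985, Sect. 10.2 (8)-(10)];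
[cite: DavisRabinowitz1984, Sect. 5.6.1 (5.6.1.1)].

AI-produced formalisation (H21 engines group, seat eng-quad-3 gen 66, 2026-08-24).
-/

open _root_.MeasureTheory Set intervalIntegral Real
open scoped Interval

namespace Literature.MeasureTheory.Integral

/-! ### One-dimensional substitutions on the polar angle `φ ∈ [0, π]` -/

/-- `cos (2 arctan u) = (1 - u²)/(1 + u²)` (private copy; public ones live in files not imported here).
[cite: MarsdenWeinstein1985, Sect. 10.2 (9)] -/
private theorem cos_two_mul_arctan'' (u : ℝ) : cos (2 * arctan u) = (1 - u ^ 2) / (1 + u ^ 2) := by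
  have h1 : (0 : ℝ) < 1 + u ^ 2 := by positivity
  rw [cos_two_mul, cos_sq_arctan]
  field_simp
  ring

/-- `sin (2 arctan u) = 2u/(1 + u²)`. [cite: MarsdenWeinstein1985, Sect. 10.2 (8)] -/
private theorem sin_two_mul_arctan'' (u : ℝ) : sin (2 * arctan u) = 2 * u / (1 + u ^ 2) := by
  have h1 : (0 : ℝ) < 1 + u ^ 2 := by positivity
  rw [sin_two_mul, sin_arctan, cos_arctan, mul_assoc, div_mul_div_comm, Real.mul_self_sqrt h1.le]
  ring

/-- **Folding `[0, π]` onto `[0, π/2]`** by the reflection `φ ↦ π - φ` (`cos ↦ -cos`, `sin ↦ sin`): for `H`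
continuous, `∫ φ in 0..π, H (cos φ) (sin φ) = ∫ φ in 0..π/2, (H (cos φ) (sin φ) + H (-cos φ) (sin φ))`.
[cite: Hurley1980, Sect. 5.8 Thm. 8.5] -/
theorem integral_trig_zero_pi_eq_halfRange {H : ℝ → ℝ → ℝ} (hH : Continuous fun p : ℝ × ℝ => H p.1 p.2) :
    ∫ φ in (0:ℝ)..π, H (cos φ) (sin φ) =
      ∫ φ in (0:ℝ)..(π / 2), (H (cos φ) (sin φ) + H (-cos φ) (sin φ)) := by
  have hc : Continuous fun φ : ℝ => H (cos φ) (sin φ) := hH.comp (continuous_cos.prodMk continuous_sin)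
  have hc' : Continuous fun φ : ℝ => H (-cos φ) (sin φ) := hH.comp (continuous_cos.neg.prodMk continuous_sin)
  have split : ∫ φ in (0:ℝ)..π, H (cos φ) (sin φ) =
      (∫ φ in (0:ℝ)..(π / 2), H (cos φ) (sin φ)) + ∫ φ in (π / 2)..π, H (cos φ) (sin φ) :=
    (integral_add_adjacent_intervals (hc.intervalIntegrable _ _) (hc.intervalIntegrable _ _)).symm
  have hrefl : ∫ φ in (π / 2)..π, H (cos φ) (sin φ) = ∫ x in (0:ℝ)..(π / 2), H (-cos x) (sin x) := by
    have e := intervalIntegral.integral_comp_sub_left (fun φ : ℝ => H (cos φ) (sin φ)) (a := 0) (b := π / 2) π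
    rw [sub_zero, show π - π / 2 = π / 2 by ring] at e
    rw [← e]
    refine intervalIntegral.integral_congr fun x _ => ?_
    simp only [cos_pi_sub, sin_pi_sub]
  rw [split, hrefl, ← intervalIntegral.integral_add (hc.intervalIntegrable _ _) (hc'.intervalIntegrable _ _)]

/-- **The polar angle by the tangent half-angle substitution** `φ = 2 arctan v`, `v ∈ [0, 1]`
(`cos φ = (1 - v²)/(1 + v²)`, `sin φ = 2v/(1 + v²)`, `dφ = 2 dv/(1 + v²)`), after the reflection fold: for `H`
continuous, `∫ φ in 0..π, H (cos φ) (sin φ) = ∫ v in 0..1, 2/(1+v²) · (H c s + H (-c) s)`.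
[cite: MarsdenWeinstein1985, Sect. 10.2 (8)-(10)] [cite: Hurley1980, Sect. 5.8 Thm. 8.5] -/
theorem integral_trig_zero_pi_eq_integral_halfAngle {H : ℝ → ℝ → ℝ}
    (hH : Continuous fun p : ℝ × ℝ => H p.1 p.2) :
    ∫ φ in (0:ℝ)..π, H (cos φ) (sin φ) =
      ∫ v in (0:ℝ)..1, 2 / (1 + v ^ 2) *
        (H ((1 - v ^ 2) / (1 + v ^ 2)) (2 * v / (1 + v ^ 2)) +
          H (-((1 - v ^ 2) / (1 + v ^ 2))) (2 * v / (1 + v ^ 2))) := by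
  have hc : Continuous fun φ : ℝ => H (cos φ) (sin φ) := hH.comp (continuous_cos.prodMk continuous_sin)
  have hc' : Continuous fun φ : ℝ => H (-cos φ) (sin φ) := hH.comp (continuous_cos.neg.prodMk continuous_sin)
  have hderiv : ∀ v ∈ uIcc (0:ℝ) 1, HasDerivAt (fun v : ℝ => 2 * arctan v) (2 * (1 / (1 + v ^ 2))) v :=
    fun v _ => (hasDerivAt_arctan v).const_mul 2
  have hφ' : Continuous fun v : ℝ => 2 * (1 / (1 + v ^ 2)) :=
    continuous_const.mul (continuous_const.div (by fun_prop) fun v => by positivity)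
  have hG : Continuous fun φ : ℝ => H (cos φ) (sin φ) + H (-cos φ) (sin φ) := hc.add hc'
  have hsub := intervalIntegral.integral_comp_mul_deriv hderiv hφ'.continuousOn hG
  rw [arctan_zero, arctan_one, mul_zero, show (2 : ℝ) * (π / 4) = π / 2 by ring] at hsub
  rw [integral_trig_zero_pi_eq_halfRange hH, ← hsub]
  refine intervalIntegral.integral_congr fun v _ => ?_
  simp only [Function.comp_apply, cos_two_mul_arctan'', sin_two_mul_arctan'']
  ring

/-- **The polar angle by `t = cos φ`** (`dt = -sin φ dφ`; on `[0, π]`, `sin φ = √(1 - cos² φ)`), absorbing the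
weight `sin φ`: for `H` continuous, `∫ φ in 0..π, sin φ * H (cos φ) (sin φ) = ∫ t in -1..1, H t √(1 - t²)`.
[cite: Hurley1980, Sect. 5.8 Thm. 8.5] -/
theorem integral_sin_mul_trig_zero_pi_eq_integral_cos {H : ℝ → ℝ → ℝ}
    (hH : Continuous fun p : ℝ × ℝ => H p.1 p.2) :
    ∫ φ in (0:ℝ)..π, sin φ * H (cos φ) (sin φ) = ∫ t in (-1:ℝ)..1, H t (√(1 - t ^ 2)) := by
  have hGc : Continuous fun t : ℝ => H t (√(1 - t ^ 2)) :=
    hH.comp (continuous_id.prodMk ((continuous_const.sub (continuous_pow 2)).sqrt))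
  have hderiv : ∀ x ∈ uIcc (0:ℝ) π, HasDerivAt cos (-sin x) x := fun x _ => hasDerivAt_cos x
  have hcont : ContinuousOn (fun x : ℝ => -sin x) (uIcc (0:ℝ) π) := continuous_sin.neg.continuousOn
  have hsub := intervalIntegral.integral_comp_mul_deriv hderiv hcont hGc
  rw [cos_zero, cos_pi, intervalIntegral.integral_symm (-1:ℝ) 1] at hsub
  have key : ∫ φ in (0:ℝ)..π, sin φ * H (cos φ) (sin φ) =
      -∫ x in (0:ℝ)..π, ((fun t : ℝ => H t (√(1 - t ^ 2))) ∘ cos) x * -sin x := by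
    rw [← intervalIntegral.integral_neg]
    refine intervalIntegral.integral_congr fun x hx => ?_
    rw [uIcc_of_le pi_pos.le] at hx
    have hs : √(1 - cos x ^ 2) = sin x := by
      rw [← sin_sq, Real.sqrt_sq (sin_nonneg_of_nonneg_of_le_pi hx.1 hx.2)]
    simp only [Function.comp_apply, hs]
    ring
  rw [key, hsub, neg_neg]

/-! ### The azimuth `θ ∈ [-π, π]`: the half-angle forms of `PolarSectorIntegral` for a general `H (cos θ, sin θ)` -/

/-- **Full circle, two terms over `u ∈ [-1, 1]`**: for `H` continuous,
`∫ θ in -π..π, H (cos θ) (sin θ) = ∫ u in -1..1, 2/(1+u²) · (H c s + H (-c) (-s))`, `c = (1-u²)/(1+u²)`,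
`s = 2u/(1+u²)` (from `integral_polarIntegrand_eq_integral_halfAngle` with `r = 1`).
[cite: MarsdenWeinstein1985, Sect. 10.2 (8)-(10)] [cite: Hurley1980, Sect. 5.5 Thm. 5.2] -/
theorem integral_trig_negPi_pi_eq_integral_halfAngle {H : ℝ → ℝ → ℝ}
    (hH : Continuous fun p : ℝ × ℝ => H p.1 p.2) :
    ∫ θ in (-π)..π, H (cos θ) (sin θ) =
      ∫ u in (-1:ℝ)..1, 2 / (1 + u ^ 2) *
        (H ((1 - u ^ 2) / (1 + u ^ 2)) (2 * u / (1 + u ^ 2)) +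
          H (-((1 - u ^ 2) / (1 + u ^ 2))) (-(2 * u / (1 + u ^ 2)))) := by
  have h := integral_polarIntegrand_eq_integral_halfAngle (f := fun p : ℝ × ℝ => H p.1 p.2) hH 1
  simpa only [one_mul] using h

/-- **Full circle, four terms over `u ∈ [0, 1]`**: for `H` continuous,
`∫ θ in -π..π, H (cos θ) (sin θ) = ∫ u in 0..1, 2/(1+u²) · (H c s + H (-c) (-s) + (H c (-s) + H (-c) s))`
(from `integral_polarIntegrand_eq_integral_halfAngle₄` with `r = 1`).
[cite: MarsdenWeinstein1985, Sect. 10.2 (8)-(10)] [cite: Hurley1980, Sect. 5.5 Thm. 5.2] -/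
theorem integral_trig_negPi_pi_eq_integral_halfAngle₄ {H : ℝ → ℝ → ℝ}
    (hH : Continuous fun p : ℝ × ℝ => H p.1 p.2) :
    ∫ θ in (-π)..π, H (cos θ) (sin θ) =
      ∫ u in (0:ℝ)..1, 2 / (1 + u ^ 2) *
        (H ((1 - u ^ 2) / (1 + u ^ 2)) (2 * u / (1 + u ^ 2)) +
            H (-((1 - u ^ 2) / (1 + u ^ 2))) (-(2 * u / (1 + u ^ 2))) +
          (H ((1 - u ^ 2) / (1 + u ^ 2)) (-(2 * u / (1 + u ^ 2))) +
            H (-((1 - u ^ 2) / (1 + u ^ 2))) (2 * u / (1 + u ^ 2)))) := by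
  have h := integral_polarIntegrand_eq_integral_halfAngle₄ (f := fun p : ℝ × ℝ => H p.1 p.2) hH 1
  simpa only [one_mul] using h

/-! ### The two angular integrals of the spherical integrand -/

/-- **`t = cos φ` in the spherical integrand**: for continuous `f` and any `ρ`, `α`, `β`,
`∫ φ in 0..π, ∫ θ in α..β, ρ² sin φ f((ρ sin φ cos θ, ρ sin φ sin θ), ρ cos φ)
   = ∫ t in -1..1, ∫ θ in α..β, ρ² f((ρ √(1-t²) cos θ, ρ √(1-t²) sin θ), ρ t)`.
[cite: Hurley1980, Sect. 5.8 Thm. 8.5] -/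
theorem integral_sphericalIntegrand_polarAngle_eq_integral_cos {f : (ℝ × ℝ) × ℝ → ℝ} (hf : Continuous f)
    (ρ α β : ℝ) :
    ∫ φ in (0:ℝ)..π, ∫ θ in α..β, ρ ^ 2 * sin φ * f ((ρ * sin φ * cos θ, ρ * sin φ * sin θ), ρ * cos φ) =
      ∫ t in (-1:ℝ)..1, ∫ θ in α..β,
        ρ ^ 2 * f ((ρ * √(1 - t ^ 2) * cos θ, ρ * √(1 - t ^ 2) * sin θ), ρ * t) := by
  have hF : Continuous fun q : (ℝ × ℝ) × ℝ =>
      ρ ^ 2 * f ((ρ * q.1.2 * cos q.2, ρ * q.1.2 * sin q.2), ρ * q.1.1) := by fun_prop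
  have hH : Continuous fun p : ℝ × ℝ =>
      ∫ θ in α..β, ρ ^ 2 * f ((ρ * p.2 * cos θ, ρ * p.2 * sin θ), ρ * p.1) :=
    intervalIntegral.continuous_parametric_intervalIntegral_of_continuous'
      (f := fun (p : ℝ × ℝ) (θ : ℝ) => ρ ^ 2 * f ((ρ * p.2 * cos θ, ρ * p.2 * sin θ), ρ * p.1)) hF α β
  have h1 := integral_sin_mul_trig_zero_pi_eq_integral_cos
    (H := fun c s => ∫ θ in α..β, ρ ^ 2 * f ((ρ * s * cos θ, ρ * s * sin θ), ρ * c)) hH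
  rw [← h1]
  refine intervalIntegral.integral_congr fun φ _ => ?_
  rw [← intervalIntegral.integral_const_mul]
  refine intervalIntegral.integral_congr fun θ _ => ?_
  ring

/-- **The polar angle by the half-angle substitution in the spherical integrand** (`v ∈ [0, 1]`, two terms,
everything rational in `v`): for continuous `f` and any `ρ`, `α`, `β`, with `c = (1-v²)/(1+v²)`, `s = 2v/(1+v²)`,
`∫ φ in 0..π, ∫ θ in α..β, ρ² sin φ f((ρ sin φ cos θ, ρ sin φ sin θ), ρ cos φ)
   = ∫ v in 0..1, ∫ θ in α..β, 2/(1+v²) · (ρ² s f((ρ s cos θ, ρ s sin θ), ρ c) + ρ² s f((ρ s cos θ, ρ s sin θ), ρ (-c)))`.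
[cite: MarsdenWeinstein1985, Sect. 10.2 (8)-(10)] [cite: Hurley1980, Sect. 5.8 Thm. 8.5] -/
theorem integral_sphericalIntegrand_polarAngle_eq_integral_halfAngle {f : (ℝ × ℝ) × ℝ → ℝ} (hf : Continuous f)
    (ρ α β : ℝ) :
    ∫ φ in (0:ℝ)..π, ∫ θ in α..β, ρ ^ 2 * sin φ * f ((ρ * sin φ * cos θ, ρ * sin φ * sin θ), ρ * cos φ) =
      ∫ v in (0:ℝ)..1, ∫ θ in α..β, 2 / (1 + v ^ 2) *
        (ρ ^ 2 * (2 * v / (1 + v ^ 2)) *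
            f ((ρ * (2 * v / (1 + v ^ 2)) * cos θ, ρ * (2 * v / (1 + v ^ 2)) * sin θ),
              ρ * ((1 - v ^ 2) / (1 + v ^ 2))) +
          ρ ^ 2 * (2 * v / (1 + v ^ 2)) *
            f ((ρ * (2 * v / (1 + v ^ 2)) * cos θ, ρ * (2 * v / (1 + v ^ 2)) * sin θ),
              ρ * -((1 - v ^ 2) / (1 + v ^ 2)))) := by
  have hF : Continuous fun q : (ℝ × ℝ) × ℝ =>
      ρ ^ 2 * q.1.2 * f ((ρ * q.1.2 * cos q.2, ρ * q.1.2 * sin q.2), ρ * q.1.1) := by fun_prop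
  have hH : Continuous fun p : ℝ × ℝ =>
      ∫ θ in α..β, ρ ^ 2 * p.2 * f ((ρ * p.2 * cos θ, ρ * p.2 * sin θ), ρ * p.1) :=
    intervalIntegral.continuous_parametric_intervalIntegral_of_continuous'
      (f := fun (p : ℝ × ℝ) (θ : ℝ) => ρ ^ 2 * p.2 * f ((ρ * p.2 * cos θ, ρ * p.2 * sin θ), ρ * p.1)) hF α β
  have h1 := integral_trig_zero_pi_eq_integral_halfAngle
    (H := fun c s => ∫ θ in α..β, ρ ^ 2 * s * f ((ρ * s * cos θ, ρ * s * sin θ), ρ * c)) hH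
  rw [h1]
  refine intervalIntegral.integral_congr fun v _ => ?_
  have hA : Continuous fun θ : ℝ => ρ ^ 2 * (2 * v / (1 + v ^ 2)) *
      f ((ρ * (2 * v / (1 + v ^ 2)) * cos θ, ρ * (2 * v / (1 + v ^ 2)) * sin θ),
        ρ * ((1 - v ^ 2) / (1 + v ^ 2))) := by fun_prop
  have hB : Continuous fun θ : ℝ => ρ ^ 2 * (2 * v / (1 + v ^ 2)) *
      f ((ρ * (2 * v / (1 + v ^ 2)) * cos θ, ρ * (2 * v / (1 + v ^ 2)) * sin θ),
        ρ * -((1 - v ^ 2) / (1 + v ^ 2))) := by fun_prop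
  rw [← intervalIntegral.integral_add (hA.intervalIntegrable _ _) (hB.intervalIntegrable _ _),
    ← intervalIntegral.integral_const_mul]

/-! ### Regions: spherical wedges with the full polar angle, shells, balls -/

/-- **Spherical wedge** `sphericalBox ρ₁ ρ₂ 0 π α β` (full polar angle) in `t = cos φ` form: for
`0 ≤ ρ₁ ≤ ρ₂`, `-π ≤ α ≤ β ≤ π` and continuous `f`,
`∫ p in sphericalBox ρ₁ ρ₂ 0 π α β, f p = ∫ ρ in ρ₁..ρ₂, ∫ t in -1..1, ∫ θ in α..β, ρ² f((ρ s cos θ, ρ s sin θ), ρ t)`,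
`s = √(1 - t²)`. [cite: Hurley1980, Sect. 5.8 Thm. 8.5] -/
theorem setIntegral_sphericalBox_polarFull_eq_iterated_cos {ρ₁ ρ₂ α β : ℝ} (hρ₁ : 0 ≤ ρ₁) (hρ : ρ₁ ≤ ρ₂)
    (hα : -π ≤ α) (hαβ : α ≤ β) (hβ : β ≤ π) {f : (ℝ × ℝ) × ℝ → ℝ} (hf : Continuous f) :
    ∫ p in sphericalBox ρ₁ ρ₂ 0 π α β, f p =
      ∫ ρ in ρ₁..ρ₂, ∫ t in (-1:ℝ)..1, ∫ θ in α..β,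
        ρ ^ 2 * f ((ρ * √(1 - t ^ 2) * cos θ, ρ * √(1 - t ^ 2) * sin θ), ρ * t) := by
  rw [setIntegral_sphericalBox_eq_iterated_of_continuous hρ₁ hρ le_rfl pi_pos.le le_rfl hα hαβ hβ hf]
  exact intervalIntegral.integral_congr fun ρ _ =>
    integral_sphericalIntegrand_polarAngle_eq_integral_cos hf ρ α β

/-- **Shell** in `t = cos φ` form: for `0 ≤ R₁ ≤ R₂` and continuous `f`,
`∫ p in {R₁² ≤ x²+y²+z² ≤ R₂²}, f p = ∫ ρ in R₁..R₂, ∫ t in -1..1, ∫ θ in -π..π, ρ² f((ρ s cos θ, ρ s sin θ), ρ t)`.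
[cite: Hurley1980, Sect. 5.8 Thm. 8.5] -/
theorem setIntegral_shell_eq_iterated_cos {R₁ R₂ : ℝ} (hR₁ : 0 ≤ R₁) (hR : R₁ ≤ R₂) {f : (ℝ × ℝ) × ℝ → ℝ}
    (hf : Continuous f) :
    ∫ p in {p : (ℝ × ℝ) × ℝ |
        R₁ ^ 2 ≤ p.1.1 ^ 2 + p.1.2 ^ 2 + p.2 ^ 2 ∧ p.1.1 ^ 2 + p.1.2 ^ 2 + p.2 ^ 2 ≤ R₂ ^ 2}, f p =
      ∫ ρ in R₁..R₂, ∫ t in (-1:ℝ)..1, ∫ θ in (-π)..π,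
        ρ ^ 2 * f ((ρ * √(1 - t ^ 2) * cos θ, ρ * √(1 - t ^ 2) * sin θ), ρ * t) := by
  rw [← sphericalBox_eq_shell hR₁ (hR₁.trans hR)]
  exact setIntegral_sphericalBox_polarFull_eq_iterated_cos hR₁ hR le_rfl (by linarith [pi_pos]) le_rfl hf

/-- **Ball** in `t = cos φ` form: for `0 ≤ R` and continuous `f`,
`∫ p in {x²+y²+z² ≤ R²}, f p = ∫ ρ in 0..R, ∫ t in -1..1, ∫ θ in -π..π, ρ² f((ρ s cos θ, ρ s sin θ), ρ t)`,
`s = √(1 - t²)`. [cite: Hurley1980, Sect. 5.8 Thm. 8.5, Ex. 8.6] -/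
theorem setIntegral_ball_eq_iterated_cos {R : ℝ} (hR : 0 ≤ R) {f : (ℝ × ℝ) × ℝ → ℝ} (hf : Continuous f) :
    ∫ p in {p : (ℝ × ℝ) × ℝ | p.1.1 ^ 2 + p.1.2 ^ 2 + p.2 ^ 2 ≤ R ^ 2}, f p =
      ∫ ρ in (0:ℝ)..R, ∫ t in (-1:ℝ)..1, ∫ θ in (-π)..π,
        ρ ^ 2 * f ((ρ * √(1 - t ^ 2) * cos θ, ρ * √(1 - t ^ 2) * sin θ), ρ * t) := by
  rw [← sphericalBox_eq_ball hR]
  exact setIntegral_sphericalBox_polarFull_eq_iterated_cos le_rfl hR le_rfl (by linarith [pi_pos]) le_rfl hf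

/-! ### Fully `π`-free forms -/

/-- **Shell, fully `π`-free** (`t = cos φ`, `θ = 2 arctan u` folded onto `u ∈ [0, 1]`): for `0 ≤ R₁ ≤ R₂` and
continuous `f`, with `s = √(1 - t²)`, `c = (1-u²)/(1+u²)`, `s' = 2u/(1+u²)`,
`∫ p in {R₁² ≤ x²+y²+z² ≤ R₂²}, f p
   = ∫ ρ in R₁..R₂, ∫ t in -1..1, ∫ u in 0..1, 2/(1+u²) · Σ_{±,±} ρ² f((±ρ s c, ±ρ s s'), ρ t)`
— the box `[R₁, R₂] × [-1, 1] × [0, 1]`, rational endpoints, no `π`.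
[cite: Hurley1980, Sect. 5.8 Thm. 8.5] [cite: MarsdenWeinstein1985, Sect. 10.2 (8)-(10)] -/
theorem setIntegral_shell_eq_iterated_cos_halfAngle₄ {R₁ R₂ : ℝ} (hR₁ : 0 ≤ R₁) (hR : R₁ ≤ R₂)
    {f : (ℝ × ℝ) × ℝ → ℝ} (hf : Continuous f) :
    ∫ p in {p : (ℝ × ℝ) × ℝ |
        R₁ ^ 2 ≤ p.1.1 ^ 2 + p.1.2 ^ 2 + p.2 ^ 2 ∧ p.1.1 ^ 2 + p.1.2 ^ 2 + p.2 ^ 2 ≤ R₂ ^ 2}, f p =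
      ∫ ρ in R₁..R₂, ∫ t in (-1:ℝ)..1, ∫ u in (0:ℝ)..1, 2 / (1 + u ^ 2) *
        (ρ ^ 2 * f ((ρ * √(1 - t ^ 2) * ((1 - u ^ 2) / (1 + u ^ 2)),
              ρ * √(1 - t ^ 2) * (2 * u / (1 + u ^ 2))), ρ * t) +
            ρ ^ 2 * f ((ρ * √(1 - t ^ 2) * -((1 - u ^ 2) / (1 + u ^ 2)),
              ρ * √(1 - t ^ 2) * -(2 * u / (1 + u ^ 2))), ρ * t) +
          (ρ ^ 2 * f ((ρ * √(1 - t ^ 2) * ((1 - u ^ 2) / (1 + u ^ 2)),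
              ρ * √(1 - t ^ 2) * -(2 * u / (1 + u ^ 2))), ρ * t) +
            ρ ^ 2 * f ((ρ * √(1 - t ^ 2) * -((1 - u ^ 2) / (1 + u ^ 2)),
              ρ * √(1 - t ^ 2) * (2 * u / (1 + u ^ 2))), ρ * t))) := by
  rw [setIntegral_shell_eq_iterated_cos hR₁ hR hf]
  refine intervalIntegral.integral_congr fun ρ _ => intervalIntegral.integral_congr fun t _ => ?_
  have hH : Continuous fun p : ℝ × ℝ =>
      ρ ^ 2 * f ((ρ * √(1 - t ^ 2) * p.1, ρ * √(1 - t ^ 2) * p.2), ρ * t) := by fun_prop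
  exact integral_trig_negPi_pi_eq_integral_halfAngle₄
    (H := fun c s => ρ ^ 2 * f ((ρ * √(1 - t ^ 2) * c, ρ * √(1 - t ^ 2) * s), ρ * t)) hH

/-- **Ball, fully `π`-free** (`t = cos φ`, `θ = 2 arctan u` folded onto `u ∈ [0, 1]`): for `0 ≤ R` and
continuous `f`, with `s = √(1 - t²)`, `c = (1-u²)/(1+u²)`, `s' = 2u/(1+u²)`,
`∫ p in {x²+y²+z² ≤ R²}, f p = ∫ ρ in 0..R, ∫ t in -1..1, ∫ u in 0..1, 2/(1+u²) · Σ_{±,±} ρ² f((±ρ s c, ±ρ s s'), ρ t)`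
— the box `[0, R] × [-1, 1] × [0, 1]`, rational endpoints, no `π`; the form a box certificate consumes when `f`
depends on `(x, y)` through `x² + y² = ρ² (1 - t²)`.
[cite: Hurley1980, Sect. 5.8 Thm. 8.5, Ex. 8.6] [cite: MarsdenWeinstein1985, Sect. 10.2 (8)-(10)] -/
theorem setIntegral_ball_eq_iterated_cos_halfAngle₄ {R : ℝ} (hR : 0 ≤ R) {f : (ℝ × ℝ) × ℝ → ℝ}
    (hf : Continuous f) :
    ∫ p in {p : (ℝ × ℝ) × ℝ | p.1.1 ^ 2 + p.1.2 ^ 2 + p.2 ^ 2 ≤ R ^ 2}, f p =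
      ∫ ρ in (0:ℝ)..R, ∫ t in (-1:ℝ)..1, ∫ u in (0:ℝ)..1, 2 / (1 + u ^ 2) *
        (ρ ^ 2 * f ((ρ * √(1 - t ^ 2) * ((1 - u ^ 2) / (1 + u ^ 2)),
              ρ * √(1 - t ^ 2) * (2 * u / (1 + u ^ 2))), ρ * t) +
            ρ ^ 2 * f ((ρ * √(1 - t ^ 2) * -((1 - u ^ 2) / (1 + u ^ 2)),
              ρ * √(1 - t ^ 2) * -(2 * u / (1 + u ^ 2))), ρ * t) +
          (ρ ^ 2 * f ((ρ * √(1 - t ^ 2) * ((1 - u ^ 2) / (1 + u ^ 2)),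
              ρ * √(1 - t ^ 2) * -(2 * u / (1 + u ^ 2))), ρ * t) +
            ρ ^ 2 * f ((ρ * √(1 - t ^ 2) * -((1 - u ^ 2) / (1 + u ^ 2)),
              ρ * √(1 - t ^ 2) * (2 * u / (1 + u ^ 2))), ρ * t))) := by
  rw [setIntegral_ball_eq_iterated_cos hR hf]
  refine intervalIntegral.integral_congr fun ρ _ => intervalIntegral.integral_congr fun t _ => ?_
  have hH : Continuous fun p : ℝ × ℝ =>
      ρ ^ 2 * f ((ρ * √(1 - t ^ 2) * p.1, ρ * √(1 - t ^ 2) * p.2), ρ * t) := by fun_prop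
  exact integral_trig_negPi_pi_eq_integral_halfAngle₄
    (H := fun c s => ρ ^ 2 * f ((ρ * √(1 - t ^ 2) * c, ρ * √(1 - t ^ 2) * s), ρ * t)) hH

/-- **Ball, all-rational form** (`φ = 2 arctan v` and `θ = 2 arctan u`, both folded onto `[0, 1]`): for `0 ≤ R`
and continuous `f`, with `c = (1-v²)/(1+v²)`, `s = 2v/(1+v²)`, `c' = (1-u²)/(1+u²)`, `s' = 2u/(1+u²)`,
`∫ p in {x²+y²+z² ≤ R²}, f p
   = ∫ ρ in 0..R, ∫ v in 0..1, ∫ u in 0..1, 2/(1+u²) · Σ_{(±,±)} 2/(1+v²) · Σ_{z = ±ρ c} ρ² s f((±ρ s c', ±ρ s s'), z)`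
(eight terms) — the box `[0, R] × [0, 1] × [0, 1]`, rational endpoints, an integrand rational in `(v, u)` with
poles only at `v, u = ±i`: the form to certify an analytic `f` that is not even in `(x, y)`.
[cite: Hurley1980, Sect. 5.8 Thm. 8.5, Ex. 8.6] [cite: MarsdenWeinstein1985, Sect. 10.2 (8)-(10)] -/
theorem setIntegral_ball_eq_iterated_halfAngle₈ {R : ℝ} (hR : 0 ≤ R) {f : (ℝ × ℝ) × ℝ → ℝ}
    (hf : Continuous f) :
    ∫ p in {p : (ℝ × ℝ) × ℝ | p.1.1 ^ 2 + p.1.2 ^ 2 + p.2 ^ 2 ≤ R ^ 2}, f p =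
      ∫ ρ in (0:ℝ)..R, ∫ v in (0:ℝ)..1, ∫ u in (0:ℝ)..1, 2 / (1 + u ^ 2) *
        (2 / (1 + v ^ 2) *
              (ρ ^ 2 * (2 * v / (1 + v ^ 2)) *
                  f ((ρ * (2 * v / (1 + v ^ 2)) * ((1 - u ^ 2) / (1 + u ^ 2)),
                      ρ * (2 * v / (1 + v ^ 2)) * (2 * u / (1 + u ^ 2))), ρ * ((1 - v ^ 2) / (1 + v ^ 2))) +
                ρ ^ 2 * (2 * v / (1 + v ^ 2)) *
                  f ((ρ * (2 * v / (1 + v ^ 2)) * ((1 - u ^ 2) / (1 + u ^ 2)),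
                      ρ * (2 * v / (1 + v ^ 2)) * (2 * u / (1 + u ^ 2))), ρ * -((1 - v ^ 2) / (1 + v ^ 2)))) +
            2 / (1 + v ^ 2) *
              (ρ ^ 2 * (2 * v / (1 + v ^ 2)) *
                  f ((ρ * (2 * v / (1 + v ^ 2)) * -((1 - u ^ 2) / (1 + u ^ 2)),
                      ρ * (2 * v / (1 + v ^ 2)) * -(2 * u / (1 + u ^ 2))), ρ * ((1 - v ^ 2) / (1 + v ^ 2))) +
                ρ ^ 2 * (2 * v / (1 + v ^ 2)) *
                  f ((ρ * (2 * v / (1 + v ^ 2)) * -((1 - u ^ 2) / (1 + u ^ 2)),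
                      ρ * (2 * v / (1 + v ^ 2)) * -(2 * u / (1 + u ^ 2))), ρ * -((1 - v ^ 2) / (1 + v ^ 2)))) +
          (2 / (1 + v ^ 2) *
              (ρ ^ 2 * (2 * v / (1 + v ^ 2)) *
                  f ((ρ * (2 * v / (1 + v ^ 2)) * ((1 - u ^ 2) / (1 + u ^ 2)),
                      ρ * (2 * v / (1 + v ^ 2)) * -(2 * u / (1 + u ^ 2))), ρ * ((1 - v ^ 2) / (1 + v ^ 2))) +
                ρ ^ 2 * (2 * v / (1 + v ^ 2)) *
                  f ((ρ * (2 * v / (1 + v ^ 2)) * ((1 - u ^ 2) / (1 + u ^ 2)),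
                      ρ * (2 * v / (1 + v ^ 2)) * -(2 * u / (1 + u ^ 2))), ρ * -((1 - v ^ 2) / (1 + v ^ 2)))) +
            2 / (1 + v ^ 2) *
              (ρ ^ 2 * (2 * v / (1 + v ^ 2)) *
                  f ((ρ * (2 * v / (1 + v ^ 2)) * -((1 - u ^ 2) / (1 + u ^ 2)),
                      ρ * (2 * v / (1 + v ^ 2)) * (2 * u / (1 + u ^ 2))), ρ * ((1 - v ^ 2) / (1 + v ^ 2))) +
                ρ ^ 2 * (2 * v / (1 + v ^ 2)) *
                  f ((ρ * (2 * v / (1 + v ^ 2)) * -((1 - u ^ 2) / (1 + u ^ 2)),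
                      ρ * (2 * v / (1 + v ^ 2)) * (2 * u / (1 + u ^ 2))), ρ * -((1 - v ^ 2) / (1 + v ^ 2)))))) := by
  rw [setIntegral_ball_eq_iterated_of_continuous hR hf]
  refine intervalIntegral.integral_congr fun ρ _ => ?_
  rw [integral_sphericalIntegrand_polarAngle_eq_integral_halfAngle hf ρ (-π) π]
  refine intervalIntegral.integral_congr fun v _ => ?_
  have hH : Continuous fun p : ℝ × ℝ => 2 / (1 + v ^ 2) *
      (ρ ^ 2 * (2 * v / (1 + v ^ 2)) *
          f ((ρ * (2 * v / (1 + v ^ 2)) * p.1, ρ * (2 * v / (1 + v ^ 2)) * p.2), ρ * ((1 - v ^ 2) / (1 + v ^ 2))) +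
        ρ ^ 2 * (2 * v / (1 + v ^ 2)) *
          f ((ρ * (2 * v / (1 + v ^ 2)) * p.1, ρ * (2 * v / (1 + v ^ 2)) * p.2),
            ρ * -((1 - v ^ 2) / (1 + v ^ 2)))) := by
    have h1 : (0 : ℝ) < 1 + v ^ 2 := by positivity
    fun_prop (disch := exact h1.ne')
  exact integral_trig_negPi_pi_eq_integral_halfAngle₄
    (H := fun c' s' => 2 / (1 + v ^ 2) *
      (ρ ^ 2 * (2 * v / (1 + v ^ 2)) *
          f ((ρ * (2 * v / (1 + v ^ 2)) * c', ρ * (2 * v / (1 + v ^ 2)) * s'), ρ * ((1 - v ^ 2) / (1 + v ^ 2))) +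
        ρ ^ 2 * (2 * v / (1 + v ^ 2)) *
          f ((ρ * (2 * v / (1 + v ^ 2)) * c', ρ * (2 * v / (1 + v ^ 2)) * s'),
            ρ * -((1 - v ^ 2) / (1 + v ^ 2))))) hH

end Literature.MeasureTheory.Integral
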